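import Literature.AlgebraicGeometry.Frobenioids.DirectSumPrimes
import Literature.AlgebraicGeometry.Frobenioids.RlfPerfFactorial
import Literature.AlgebraicGeometry.Frobenioids.FactorizationTransport
import Literature.AlgebraicGeometry.Frobenioids.PerfectionDivisorial
import HarnessLib

/-!
# Frobenioids I, Def. 2.4 (i): a FULL product `∏_i P_i` of perfect monoprime monoids is perf-factorial

Mochizuki, *The geometry of Frobenioids I*, Kyushu J. Math. **62** (2008), §0 pp. 10–12 (sharp, integral,
saturated monoids; primary elements, primes `Prime(M)`, `M_𝔭`; monoprime monoids) and §2, Definition 2.4 (i)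
p. 47 (perf-factorial monoids, conditions (a)–(d)) [cite: MochizukiFrdI2008, Def. 2.4(i) p.47].

The tree proves perf-factoriality for DIRECT SUMS `⊕_i M_i` of monoprime monoids (`DirectSumPerfFactorial.lean`,
seat abc-iut-L1-d2: the divisor monoids of the motivating examples, finitely supported).  Condition (d) of
Def. 2.4 (i), however, allows — indeed forces, as soon as one infinitely supported element is present — FULL
product blocks: `M^pf ⊇ ∏_{𝔮 ∈ Supp b} M^pf_𝔮` for every `b ∈ M^pf`.  This file records the basic example of
that phenomenon: for a family `P_i` of PERFECT monoprime monoids (`ℚ_{≥0}`, `ℝ_{≥0}`), the full product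
`∏_i P_i` (ALL families, no support condition) is perf-factorial: (a) divisorial; (b) primary elements are the
families supported at one index, `Prime(∏ P_i) ≃ ι`, `(∏ P_i)_𝔭 ≅ P_i` monoprime; (c) the factorization map is
`f ↦ (f|_i ⊗ 1)_i`, an injective homomorphism; (d) is automatic (every element of `∏_𝔭 (∏ P)_𝔭` glues).
(Perfectness is needed: `∏_ℕ ℤ_{≥0}` is NOT perf-factorial, `PerfFactorialProductCounterexample.lean`.)

It is the carrier of the set-theoretic witness of finding P53-F2 (`RealificationMapInjectiveIndependence.lean`,
seat abc-iut-w4-d084): out of a full product `∏_A ℚ_{≥0}` over an index set carrying a countably complete free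
ultrafilter there are "ghost" homomorphisms invisible on primary elements.  The proofs follow
`DirectSumMonoids/Primes/Factorization.lean` line by line with the support condition removed.
Seat abc-iut-w4-d084 (cell abc-iut; sub-DAG W3 row P53/L02a′, GAP-LEDGER G-w4d084-1).
-/

noncomputable section

namespace Literature.AlgebraicGeometry.Frobenioids

open Function Literature.AnabelianGeometry.EtaleTheta

universe u v

namespace PiMonoprime

variable {ι : Type u} {P : ι → Type v} [∀ i, CommMonoid (P i)]

/-! ### Divisibility in a full product -/

/-- Divisibility in `∏_i P_i` is componentwise. [cite: MochizukiFrdI2008, §0 p.12] -/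
theorem dvd_iff (f g : ∀ i, P i) : f ∣ g ↔ ∀ i, f i ∣ g i := by
  constructor
  · rintro ⟨c, rfl⟩ i
    exact ⟨c i, rfl⟩
  · intro h
    choose c hc using h
    exact ⟨c, funext hc⟩

/-- `f ≼ g` in `∏_i P_i` iff `∃ n ≥ 1, f_i ≤ n · g_i` for all `i`. [cite: MochizukiFrdI2008, §0 p.12] -/
theorem precsim_iff (f g : ∀ i, P i) : f ≼ g ↔ ∃ n : ℕ, 0 < n ∧ ∀ i, f i ∣ g i ^ n := by
  simp only [Precsim, dvd_iff, Pi.pow_apply]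

/-- `∏_i P_i` is sharp when all `P_i` are. [cite: MochizukiFrdI2008, §0 p.11] -/
theorem isSharp (hP : ∀ i, IsSharp (P i)) : IsSharp (∀ i, P i) := by
  refine ⟨fun f hf => funext fun i => ?_⟩
  obtain ⟨g, hfg⟩ := hf.exists_right_inv
  exact (hP i).1 _ (IsUnit.of_mul_eq_one (g i) (by rw [← Pi.mul_apply, hfg, Pi.one_apply]))

/-- `f ∣ g` implies `supp f ⊆ supp g` (sharp factors). [cite: MochizukiFrdI2008, §0 p.12] -/
theorem dsupp_subset_of_dvd (hP : ∀ i, IsSharp (P i)) {f g : ∀ i, P i} (h : f ∣ g) : dsupp f ⊆ dsupp g := by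
  intro i hi hgi
  obtain ⟨c, hc⟩ := (dvd_iff f g).mp h i
  rw [hgi] at hc
  exact hi ((hP i).1 _ (IsUnit.of_mul_eq_one _ hc.symm))

/-- `f ≼ g` implies `supp f ⊆ supp g` (sharp factors). [cite: MochizukiFrdI2008, §0 p.12] -/
theorem dsupp_subset_of_precsim (hP : ∀ i, IsSharp (P i)) {f g : ∀ i, P i} (h : f ≼ g) :
    dsupp f ⊆ dsupp g := by
  obtain ⟨n, -, h⟩ := h
  exact (dsupp_subset_of_dvd hP h).trans (dsupp_pow_subset g n)

/-- An element is `≠ 1` iff its support is nonempty. [cite: MochizukiFrdI2008, §0 p.12] -/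
theorem ne_one_iff_dsupp_nonempty (f : ∀ i, P i) : f ≠ 1 ↔ (dsupp f).Nonempty := by
  constructor
  · intro hf
    by_contra h
    apply hf
    funext i
    by_contra hi
    exact h ⟨i, hi⟩
  · rintro ⟨i, hi⟩ rfl
    exact hi rfl

variable [DecidableEq ι]

/-- An element supported inside `{i}` is `mulSingle i` of its `i`-component. [cite: MochizukiFrdI2008, §0 p.12] -/
theorem eq_mulSingle_of_dsupp_subset {f : ∀ j, P j} {i : ι} (h : dsupp f ⊆ {i}) : f = Pi.mulSingle i (f i) := by
  funext j
  by_cases hji : j = i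
  · subst hji
    rw [Pi.mulSingle_eq_same]
  · rw [Pi.mulSingle_eq_of_ne hji]
    by_contra hfj
    exact hji (h hfj)

/-- `supp (mulSingle i a) ⊆ {i}`. [cite: MochizukiFrdI2008, §0 p.12] -/
theorem dsupp_mulSingle_subset (i : ι) (a : P i) : dsupp (Pi.mulSingle i a : ∀ j, P j) ⊆ {i} := fun j hj => by
  by_contra hji
  exact hj (Pi.mulSingle_eq_of_ne hji a)

/-- `supp (mulSingle i a) = {i}` for `a ≠ 1`. [cite: MochizukiFrdI2008, §0 p.12] -/
theorem dsupp_mulSingle {i : ι} {a : P i} (ha : a ≠ 1) : dsupp (Pi.mulSingle i a : ∀ j, P j) = {i} :=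
  Set.Subset.antisymm (dsupp_mulSingle_subset i a)
    (Set.singleton_subset_iff.mpr (by rw [mem_dsupp_iff, Pi.mulSingle_eq_same]; exact ha))

variable (hP : ∀ i, IsMonoprime (P i))
include hP

/-- For monoprime factors: `mulSingle i a ≼ f` whenever `i ∈ supp f` (each `P_i` is archimedean).
[cite: MochizukiFrdI2008, §0 p.12] -/
theorem mulSingle_precsim_of_mem_dsupp {f : ∀ j, P j} {i : ι} (hi : i ∈ dsupp f) (a : P i) :
    (Pi.mulSingle i a : ∀ j, P j) ≼ f := by
  obtain ⟨n, hn, hdvd⟩ := MonoprimeStructure.precsim_of_ne_one (hP i) (a := a) hi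
  refine (precsim_iff _ _).mpr ⟨n, hn, fun j => ?_⟩
  by_cases hji : j = i
  · subst hji
    rwa [Pi.mulSingle_eq_same]
  · rw [Pi.mulSingle_eq_of_ne hji]
    exact one_dvd _

omit [DecidableEq ι] in
/-- **`∏_i P_i` is divisorial** for monoprime `P_i`. [cite: MochizukiFrdI2008, Def. 1.1 (i) p.19] -/
theorem isDivisorial : IsDivisorial (∀ i, P i) := by
  have hsh : ∀ i, IsSharp (P i) := fun i => MonoprimeStructure.isSharp (hP i)
  haveI : ∀ i, IsCancelMul (P i) := fun i => MonoprimeStructure.isCancelMul (hP i)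
  refine isDivisorial_of_dvd_of_pow (isSharp hsh) fun a b c n hn h => ?_
  rw [dvd_iff]
  intro i
  have hi := congr_fun h i
  simp only [Pi.pow_apply, Pi.mul_apply] at hi
  exact IsMonoprime.dvd_of_pow_eq_mul_pow (hP i) hn hi

/-! ### Primary elements and primes: `Prime(∏_i P_i) ≃ ι` -/

/-- **An element of `∏_i P_i` (monoprime factors) is primary iff its support is a single index.**
[cite: MochizukiFrdI2008, §0 p.12] -/
theorem isPrimary_iff (f : ∀ j, P j) : IsPrimary f ↔ ∃ i, dsupp f = {i} := by
  have hsh : ∀ i, IsSharp (P i) := fun i => MonoprimeStructure.isSharp (hP i)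
  constructor
  · intro hf
    obtain ⟨i, hi⟩ := (ne_one_iff_dsupp_nonempty f).mp hf.1
    refine ⟨i, Set.Subset.antisymm ?_ (Set.singleton_subset_iff.mpr hi)⟩
    have hne : (Pi.mulSingle i (f i) : ∀ j, P j) ≠ 1 := by
      rw [ne_one_iff_dsupp_nonempty, dsupp_mulSingle hi]
      exact Set.singleton_nonempty i
    have hle : (Pi.mulSingle i (f i) : ∀ j, P j) ≼ f := mulSingle_precsim_of_mem_dsupp hP hi _
    have := dsupp_subset_of_precsim hsh (hf.2 _ hne hle)
    rwa [dsupp_mulSingle hi] at this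
  · rintro ⟨i, hi⟩
    refine ⟨(ne_one_iff_dsupp_nonempty f).mpr (by rw [hi]; exact Set.singleton_nonempty i), fun b hb hbf => ?_⟩
    have hsub : dsupp b ⊆ {i} := hi ▸ dsupp_subset_of_precsim hsh hbf
    obtain ⟨j, hj⟩ := (ne_one_iff_dsupp_nonempty b).mp hb
    have hji : j = i := hsub hj
    subst hji
    rw [eq_mulSingle_of_dsupp_subset hi.le]
    exact mulSingle_precsim_of_mem_dsupp hP hj _

/-- `≼`-comparable primaries have the same support. [cite: MochizukiFrdI2008, §0 p.12] -/
theorem dsupp_eq_of_precsim {a b : ∀ j, P j} (ha : IsPrimary a) (hb : IsPrimary b) (hab : a ≼ b) :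
    dsupp a = dsupp b := by
  obtain ⟨i, hi⟩ := (isPrimary_iff hP a).mp ha
  obtain ⟨j, hj⟩ := (isPrimary_iff hP b).mp hb
  have h := dsupp_subset_of_precsim (fun i => MonoprimeStructure.isSharp (hP i)) hab
  rw [hi, hj, Set.singleton_subset_singleton] at h
  rw [hi, hj, h]

/-- The index supporting a primary element. [cite: MochizukiFrdI2008, §0 p.12] -/
def suppIndex (a : primaries (∀ j, P j)) : ι :=
  Classical.choose ((isPrimary_iff hP a.1).mp a.2)

/-- `supp a = {suppIndex a}`. [cite: MochizukiFrdI2008, §0 p.12] -/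
theorem dsupp_eq_suppIndex (a : primaries (∀ j, P j)) : dsupp a.1 = {suppIndex hP a} :=
  Classical.choose_spec ((isPrimary_iff hP a.1).mp a.2)

/-- `Prime(∏_i P_i) → ι`: the supporting index of a class. [cite: MochizukiFrdI2008, §0 p.12] -/
def idx : Primes (∀ j, P j) → ι :=
  Quotient.lift (suppIndex hP) fun a b hab => by
    have := dsupp_eq_of_precsim hP a.2 b.2 hab
    rw [dsupp_eq_suppIndex hP, dsupp_eq_suppIndex hP, Set.singleton_eq_singleton_iff] at this
    exact this

/-- `idx` on a class. [cite: MochizukiFrdI2008, §0 p.12] -/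
theorem idx_mk (a : ∀ j, P j) (ha : IsPrimary a) :
    dsupp a = {idx hP (Quotient.mk (primarySetoid (∀ j, P j)) ⟨a, ha⟩)} :=
  dsupp_eq_suppIndex hP ⟨a, ha⟩

/-- `mulSingle i (gen i)` is primary (`gen i` a chosen non-unit of `P_i`). [cite: MochizukiFrdI2008, §0 p.12] -/
theorem isPrimary_mulSingle_gen (i : ι) : IsPrimary (Pi.mulSingle i (DirectSum.gen hP i) : ∀ j, P j) :=
  (isPrimary_iff hP _).mpr ⟨i, dsupp_mulSingle (DirectSum.gen_ne_one hP i)⟩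

/-- `ι → Prime(∏_i P_i)`: the class of `mulSingle i ε`. [cite: MochizukiFrdI2008, §0 p.12] -/
def primeOf (i : ι) : Primes (∀ j, P j) :=
  Quotient.mk (primarySetoid (∀ j, P j)) ⟨Pi.mulSingle i (DirectSum.gen hP i), isPrimary_mulSingle_gen hP i⟩

/-- `idx (primeOf i) = i`. [cite: MochizukiFrdI2008, §0 p.12] -/
theorem idx_primeOf (i : ι) : idx hP (primeOf hP i) = i := by
  have h1 := idx_mk hP (Pi.mulSingle i (DirectSum.gen hP i)) (isPrimary_mulSingle_gen hP i)
  rw [dsupp_mulSingle (DirectSum.gen_ne_one hP i), Set.singleton_eq_singleton_iff] at h1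
  exact h1.symm

/-- `primeOf (idx 𝔭) = 𝔭`. [cite: MochizukiFrdI2008, §0 p.12] -/
theorem primeOf_idx (Q : Primes (∀ j, P j)) : primeOf hP (idx hP Q) = Q := by
  induction Q using Quotient.inductionOn with
  | h a =>
    apply Quotient.sound
    show (Pi.mulSingle _ _ : ∀ j, P j) ≼ a.1
    apply mulSingle_precsim_of_mem_dsupp hP
    show suppIndex hP a ∈ dsupp a.1
    rw [dsupp_eq_suppIndex hP a]
    rfl

/-- **`Prime(∏_i P_i) ≃ ι`.** [cite: MochizukiFrdI2008, §0 p.12] -/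
def primesEquiv : Primes (∀ j, P j) ≃ ι where
  toFun := idx hP
  invFun := primeOf hP
  left_inv := primeOf_idx hP
  right_inv := idx_primeOf hP

/-- The subset of the prime of `i`: the elements supported exactly at `i`. [cite: MochizukiFrdI2008, §0 p.12] -/
theorem mem_carrier_primeOf_iff (i : ι) (a : ∀ j, P j) :
    a ∈ (primeOf hP i).carrier ↔ dsupp a = {i} := by
  constructor
  · rintro ⟨ha, hQ⟩
    rw [idx_mk hP a ha, hQ, idx_primeOf]
  · intro hs
    have ha : IsPrimary a := (isPrimary_iff hP a).mpr ⟨i, hs⟩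
    refine ⟨ha, ?_⟩
    have h1 := idx_mk hP a ha
    rw [hs, Set.singleton_eq_singleton_iff] at h1
    rw [← primeOf_idx hP (Quotient.mk (primarySetoid (∀ j, P j)) ⟨a, ha⟩), ← h1]

/-- The subset of an arbitrary prime `𝔭`: the elements supported exactly at `idx 𝔭`.
[cite: MochizukiFrdI2008, §0 p.12] -/
theorem mem_carrier_iff (Q : Primes (∀ j, P j)) (a : ∀ j, P j) :
    a ∈ Q.carrier ↔ dsupp a = {idx hP Q} := by
  have := mem_carrier_primeOf_iff hP (idx hP Q) a
  rwa [primeOf_idx] at this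

/-- **`(∏_i P_i)_𝔭 = {a | supp a ⊆ {i}}`** for the prime of `i`. [cite: MochizukiFrdI2008, §0 p.12] -/
theorem mem_submonoid_primeOf_iff (i : ι) (a : ∀ j, P j) :
    a ∈ (primeOf hP i).submonoid ↔ dsupp a ⊆ {i} := by
  constructor
  · intro ha
    induction ha using Submonoid.closure_induction with
    | mem x hx => exact ((mem_carrier_primeOf_iff hP i x).mp hx).le
    | one => intro j hj; exact (hj rfl).elim
    | mul x y _ _ hx hy => exact (dsupp_mul_subset _ _).trans (Set.union_subset hx hy)
  · intro hs
    by_cases ha : a = 1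
    · rw [ha]; exact Submonoid.one_mem _
    · apply Submonoid.subset_closure
      rw [mem_carrier_primeOf_iff]
      obtain ⟨j, hj⟩ := (ne_one_iff_dsupp_nonempty a).mp ha
      have : j = i := hs hj
      subst this
      exact Set.Subset.antisymm hs (Set.singleton_subset_iff.mpr hj)

/-- `(∏ P)_𝔭 = {a | supp a ⊆ {idx 𝔭}}`. [cite: MochizukiFrdI2008, §0 p.12] -/
theorem mem_submonoid_iff (Q : Primes (∀ j, P j)) (a : ∀ j, P j) :
    a ∈ Q.submonoid ↔ dsupp a ⊆ {idx hP Q} := by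
  have := mem_submonoid_primeOf_iff hP (idx hP Q) a
  rwa [primeOf_idx] at this

/-- An element of `(∏ P)_𝔭` has trivial components away from `idx 𝔭`. [cite: MochizukiFrdI2008, §0 p.12] -/
theorem apply_eq_one_of_mem_submonoid {Q : Primes (∀ j, P j)} {a : ∀ j, P j} (ha : a ∈ Q.submonoid)
    {i : ι} (hi : i ≠ idx hP Q) : a i = 1 := by
  by_contra hne
  exact hi ((mem_submonoid_iff hP Q a).mp ha hne)

/-- **`(∏_i P_i)_𝔭 ≅ P_i`** for the prime `𝔭` of `i`: `a ↦ a_i`. [cite: MochizukiFrdI2008, §0 p.12] -/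
def submonoidEquiv (Q : Primes (∀ j, P j)) (i : ι) (e : primeOf hP i = Q) : ↥Q.submonoid ≃* P i where
  toFun x := x.1 i
  invFun y := ⟨Pi.mulSingle i y, by rw [← e, mem_submonoid_primeOf_iff]; exact dsupp_mulSingle_subset i y⟩
  left_inv x := by
    have hx : dsupp x.1 ⊆ {i} := by rw [← mem_submonoid_primeOf_iff hP, e]; exact x.2
    exact Subtype.ext (eq_mulSingle_of_dsupp_subset hx).symm
  right_inv y := Pi.mulSingle_eq_same i y
  map_mul' x y := rfl

/-- **Every `(∏_i P_i)_𝔭` is monoprime** (`≅ P_{idx 𝔭}`): condition (b) of Def. 2.4 (i).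
[cite: MochizukiFrdI2008, Def. 2.4(i) p.47] -/
theorem isMonoprime_submonoid (Q : Primes (∀ j, P j)) : IsMonoprime ↥Q.submonoid :=
  IsMonoprime.of_mulEquiv_univ (submonoidEquiv hP Q (idx hP Q) (primeOf_idx hP Q)).symm (hP (idx hP Q))

/-! ### Conditions (c), (d) relative to the primes of `∏_i P_i` -/

/-- The restriction `a|_i = mulSingle i (a i)` as an element of `(∏ P)_𝔭` (`i = idx 𝔭`).
[cite: MochizukiFrdI2008, Def. 2.4(i) p.47] -/
def res (Q : Primes (∀ j, P j)) (a : ∀ j, P j) : Factorization.PAt (∀ j, P j) Q :=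
  ⟨Pi.mulSingle (idx hP Q) (a (idx hP Q)), (mem_submonoid_iff hP Q _).mpr (dsupp_mulSingle_subset _ _)⟩

/-- `res` on underlying elements. [cite: MochizukiFrdI2008, Def. 2.4(i) p.47] -/
@[simp] theorem coe_res (Q : Primes (∀ j, P j)) (a : ∀ j, P j) :
    (res hP Q a : ∀ j, P j) = Pi.mulSingle (idx hP Q) (a (idx hP Q)) := rfl

/-- `res` is multiplicative. [cite: MochizukiFrdI2008, Def. 2.4(i) p.47] -/
theorem res_mul (Q : Primes (∀ j, P j)) (a b : ∀ j, P j) : res hP Q (a * b) = res hP Q a * res hP Q b :=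
  Subtype.ext (by rw [coe_res, Pi.mul_apply, Pi.mulSingle_mul]; rfl)

/-- `res 1 = 1`. [cite: MochizukiFrdI2008, Def. 2.4(i) p.47] -/
theorem res_one (Q : Primes (∀ j, P j)) : res hP Q 1 = 1 :=
  Subtype.ext (by rw [coe_res, Pi.one_apply, Pi.mulSingle_one]; rfl)

/-- `a|_i ⊗ 1 ∈ Bound_{𝔭 ∪ {0}}(a)`. [cite: MochizukiFrdI2008, Def. 2.4(i) p.47] -/
theorem of_res_mem_bound (Q : Primes (∀ j, P j)) (a : ∀ j, P j) :
    Realification.of _ (res hP Q a) ∈ Factorization.bound (∀ j, P j) Q a := by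
  refine ⟨res hP Q a, ?_, ?_, rfl⟩
  · by_cases ha : a (idx hP Q) = 1
    · right
      show (Pi.mulSingle (idx hP Q) (a (idx hP Q)) : ∀ j, P j) = 1
      rw [ha, Pi.mulSingle_one]
    · left
      show (Pi.mulSingle (idx hP Q) (a (idx hP Q)) : ∀ j, P j) ∈ Q.carrier
      rw [mem_carrier_iff hP]
      exact dsupp_mulSingle ha
  · show (Pi.mulSingle (idx hP Q) (a (idx hP Q)) : ∀ j, P j) ∣ a
    rw [dvd_iff]
    intro j
    by_cases hj : j = idx hP Q
    · subst hj
      rw [Pi.mulSingle_eq_same]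
    · rw [Pi.mulSingle_eq_of_ne hj]
      exact one_dvd _

/-- Every element of `Bound_{𝔭 ∪ {0}}(a)` is `≤ a|_i ⊗ 1`: the supremum is a maximum.
[cite: MochizukiFrdI2008, Def. 2.4(i) p.47] -/
theorem dvd_of_res_of_mem_bound (Q : Primes (∀ j, P j)) (a : ∀ j, P j)
    {y : Factorization.RAt (∀ j, P j) Q} (hy : y ∈ Factorization.bound (∀ j, P j) Q a) :
    y ∣ Realification.of _ (res hP Q a) := by
  have hsh : ∀ i, IsSharp (P i) := fun i => MonoprimeStructure.isSharp (hP i)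
  obtain ⟨x, _, hxa, rfl⟩ := hy
  apply map_dvd
  have hdvd : (x : ∀ j, P j) ∣ (res hP Q a : ∀ j, P j) := by
    rw [dvd_iff]
    intro j
    rw [coe_res]
    by_cases hj : j = idx hP Q
    · subst hj
      rw [Pi.mulSingle_eq_same]
      exact ((dvd_iff _ _).mp hxa) _
    · rw [apply_eq_one_of_mem_submonoid hP x.2 hj]
      exact one_dvd _
  obtain ⟨c, hc⟩ := hdvd
  have hcmem : c ∈ Q.submonoid := by
    rw [mem_submonoid_iff hP]
    refine Set.Subset.trans ?_ ((mem_submonoid_iff hP Q _).mp (res hP Q a).2)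
    rw [hc]
    intro j hj hj'
    rw [Pi.mul_apply] at hj'
    exact hj ((hsh j).1 _ (IsUnit.of_mul_eq_one _ (by rw [mul_comm]; exact hj')))
  exact ⟨⟨c, hcmem⟩, Subtype.ext hc⟩

/-- **`a|_i ⊗ 1 = sup Bound_{𝔭 ∪ {0}}(a)`**. [cite: MochizukiFrdI2008, Def. 2.4(i) p.47] -/
theorem isSup_bound (Q : Primes (∀ j, P j)) (a : ∀ j, P j) (b : Factorization.RAt (∀ j, P j) Q) :
    IsBoundedBy (Factorization.bound (∀ j, P j) Q a) b ↔ Realification.of _ (res hP Q a) ∣ b :=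
  ⟨fun hb => hb _ (of_res_mem_bound hP Q a), fun hb _ hy => (dvd_of_res_of_mem_bound hP Q a hy).trans hb⟩

/-- **The factorization map of `∏_i P_i` is `a ↦ (a|_i ⊗ 1)_𝔭`.** [cite: MochizukiFrdI2008, Def. 2.4(i) p.47] -/
theorem fmap_apply (a : ∀ j, P j) (Q : Primes (∀ j, P j)) :
    Factorization.fmap (∀ j, P j) a Q = Realification.of _ (res hP Q a) :=
  divSup_eq_of_isSup (fun _ _ => Realification.dvd_antisymm) (isSup_bound hP Q a)

/-- `N → N ⊗ ℝ_{≥0}` is injective on each `(∏ P)_𝔭` (monoprime). [cite: MochizukiFrdI2008, Def. 2.4(i) p.47] -/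
theorem of_injective (Q : Primes (∀ j, P j)) :
    Injective (Realification.of (Factorization.PAt (∀ j, P j) Q)) :=
  Realification.of_injective (isMonoprime_submonoid hP Q)

omit [DecidableEq ι] hP in
/-- Index bookkeeping: `x_𝔭` only depends on `𝔭` up to equality. [cite: MochizukiFrdI2008, Def. 2.4(i) p.47] -/
theorem coe_apply_congr (x : Factorization.PFactor (∀ j, P j)) {Q₁ Q₂ : Primes (∀ j, P j)} (e : Q₁ = Q₂) :
    ((x Q₁ : ∀ j, P j)) = ((x Q₂ : ∀ j, P j)) := by
  subst e
  rfl

/-- The preimage for condition (d): glue the `i`-components of the `x_{𝔭(i)}` — ANY family glues (no support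
condition in a full product). [cite: MochizukiFrdI2008, Def. 2.4(i) p.47] -/
def glue (x : Factorization.PFactor (∀ j, P j)) : ∀ j, P j :=
  fun i => (x (primeOf hP i) : ∀ j, P j) i

/-- `res 𝔭 (glue x) = x_𝔭`. [cite: MochizukiFrdI2008, Def. 2.4(i) p.47] -/
theorem res_glue (x : Factorization.PFactor (∀ j, P j)) (Q : Primes (∀ j, P j)) :
    res hP Q (glue hP x) = x Q := by
  apply Subtype.ext
  funext j
  show (Pi.mulSingle (idx hP Q) (glue hP x (idx hP Q)) : ∀ j, P j) j = (x Q : ∀ j, P j) j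
  by_cases hj : j = idx hP Q
  · subst hj
    rw [Pi.mulSingle_eq_same, glue, coe_apply_congr x (primeOf_idx hP Q)]
  · rw [Pi.mulSingle_eq_of_ne hj, apply_eq_one_of_mem_submonoid hP (x Q).2 hj]

/-- `a|_i` for all `𝔭` determine `a`. [cite: MochizukiFrdI2008, Def. 2.4(i) p.47] -/
theorem eq_of_res_eq {a b : ∀ j, P j} (hab : ∀ Q, res hP Q a = res hP Q b) : a = b := by
  funext i
  have h1 := congrArg (fun z : Factorization.PAt (∀ j, P j) (primeOf hP i) => (z : ∀ j, P j) i)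
    (hab (primeOf hP i))
  simp only [coe_res] at h1
  rwa [idx_primeOf, Pi.mulSingle_eq_same, Pi.mulSingle_eq_same] at h1

/-- **Conditions (c), (d) of Def. 2.4 (i) for `∏_i P_i` (monoprime `P_i`) relative to its own primes.**
[cite: MochizukiFrdI2008, Def. 2.4(i) p.47] -/
theorem cond : Factorization.Cond (∀ j, P j) where
  bounded Q a := ⟨_, (isSup_bound hP Q a _).mpr dvd_rfl⟩
  fmap_one := funext fun Q => by rw [fmap_apply hP, res_one, map_one, Pi.one_apply]
  fmap_mul a b := funext fun Q => by
    rw [Pi.mul_apply, fmap_apply hP, fmap_apply hP, fmap_apply hP, res_mul, map_mul]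
  fmap_injective a b hab := by
    apply eq_of_res_eq hP
    intro Q
    have h1 := congr_fun hab Q
    rw [fmap_apply hP, fmap_apply hP] at h1
    exact of_injective hP _ h1
  fmap_mem_range a := ⟨fun Q => res hP Q a, funext fun Q => by rw [Factorization.pToR_apply, fmap_apply hP]⟩
  mem_range_of_supp_subset x _ _ := ⟨glue hP x, funext fun Q => by
    rw [fmap_apply hP, Factorization.pToR_apply, res_glue]⟩

/-! ### The theorem -/

omit [DecidableEq ι] hP in
/-- A product of perfect monoids is perfect. [cite: MochizukiFrdI2008, §0 p.11] -/
theorem isPerfect (hperf : ∀ i, IsPerfect (P i)) : IsPerfect (∀ j, P j) := by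
  refine ⟨fun n hn => ⟨fun a b hab => funext fun i => ?_, fun b => ?_⟩⟩
  · exact ((hperf i).1 n hn).1 (congr_fun hab i)
  · choose a ha using fun i => ((hperf i).1 n hn).2 (b i)
    exact ⟨a, funext ha⟩

/-- **A full product `∏_i P_i` of PERFECT monoprime monoids is perf-factorial** (Def. 2.4 (i)): (a) divisorial,
(b) each `(∏ P)_𝔭 ≅ P_i` monoprime, (c)(d) relative to its primes, transported to `(∏ P)^pf ≅ ∏ P` (perfect).
[cite: MochizukiFrdI2008, Def. 2.4(i) p.47] -/
theorem isPerfFactorial (hperf : ∀ i, IsPerfect (P i)) : IsPerfFactorial (∀ j, P j) :=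
  IsPerfFactorial.of_cond (isDivisorial hP) (isMonoprime_submonoid hP)
    (Factorization.Cond.of_mulEquiv (isPerfect hperf).equivPerfection (cond hP))

end PiMonoprime

end Literature.AlgebraicGeometry.Frobenioids
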